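import Summits.ABC.IUTFork.Thm311RealInd1StripPacketMonomialFloor
import HarnessLib

/-!
# [IUTchIII] Thm 3.11 (i) (Ind1)+(Ind2) ⟶ Cor 3.12 Step (x), reading (P): the NO-BIT and ONE-BIT forms of the monomial-floor junction, displayed
# verbatim — `(r+2)/e_{i₀} + Σ_{i≠i₀} 1/e_i ≤ 1` (no bit anywhere) and `(r+1)/e_{i₀} + Σ_{i≠b} 1/e_i ≤ 1` (one bit, at any factor `b`) — at the packet
# and at the place-section level (modulo `JannsenWingbergMappingClass`)

PROOF-ONLY file (abc-iut cell, Cor. 3.12 sub-crew, seat abc-iut-c312-1 = holder of record of the typed [IUTchIII] Thm. 3.11, gen 19; row «R25 =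
C:NORMALISATION-TRANSFER», KEY NORMTRANSFER, C LEAD ruling C-R167 (a); companion of file (A) `Thm311RealInd1StripPacketMonomialFloor`, split off for the
400-line rule).  TAKES NO SIDE on [IUTchIII] Cor. 3.12.  No definition, no `Prop` fact; `JannsenWingbergMappingClass` the only conditional input (`hMC`).
Every theorem is the transfer form `…_eq_of_bitsOn_of_jannsenWingbergMappingClass` of file (A) at `S = ∅` / `S = {b}`, with the room inequality in the
binder VERBATIM (`r = (v − 1) mod e_{i₀}`, `Σ` over `Finset.univ.erase _`):
* §1 **`packetHull_iUnion_image_iota_smul_normalizedPacket_eq_of_room_of_jannsenWingbergMappingClass`** — NO bit, NO residue-degree hypothesis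
  ANYWHERE: `(r+2)/e_{i₀} + Σ_{i≠i₀} 1/e_i ≤ 1` ⟹ the junction identity `packetHull(H-orbit of ι_{i₀}(g)·(R_I)^∼) = packetHull(p^{A}·log_p(R_I^×))`.
* §2 **`packetHull_iUnion_image_iota_smul_normalizedPacket_eq_of_oneBit_of_jannsenWingbergMappingClass`** — ONE bit at ANY factor `b` (slot or
  not; displayed only if `f(w_b|p) = 1`): `(r+1)/e_{i₀} + Σ_{i≠b} 1/e_i ≤ 1` ⟹ the identity.  Two equally ramified factors `e`: `r ≤ e − 2`, EITHER bit.
* §3 / §4 place-section ports **`localFields_packetHull_orbitH_pilotRegion_eq_slotImagesHull_of_room_…`** / **`…_of_oneBit_…`** — the `(R_I)^∼`-hull of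
  the `H`-orbit of `O_𝕃(−P_Θ)_{v⃗}` equals `slotImagesHull` at every collection satisfying the respective inequality (as p552192 §2 for the bit family).
READING (numbers about OUR typed objects; neutral): compare R24 (p552192 §1: one bit per off-slot factor of residue degree one, and at the slot when
`e_{i₀} ∣ v`).  File (B) `Thm311RealInd1StripPacketNormalisationTransfer` shows on the two-factor example that these inequalities are SHARP there
(unconditional defects beyond them).  HONEST SCOPE as in file (A): OUR typings; conditional on `hMC`; EVEN local degree (NOT typed), WILD, `p = 2` remain;
nothing here decides any bit; equal-AS-TYPED ≠ equal in print; nothing here asserts that abc is proved or refuted; no side taken on [IUTchIII] Cor. 3.12 /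
[IUTchIV] Thm. 1.10, on (U) vs (P), or on any author. [claim: Mochizuki2012, status: disputed];
[cite: Mochizuki2012, IUTchIII Thm. 3.11 (i) p. 154; Rmk. 3.9.5 (i) p. 127; Cor. 3.12 Step (x)/(xi) pp. 181–183; IUTchIV Prop. 1.1 p. 9, Prop. 1.2 (ii) pp. 10–11];
[cite: Kondo2025OuterAutMLF, §3 Thm 3.17, Rem 3.18]; [cite: DupuyHilado2025, §4.9, §4.12]. typed ≠ proved; a conditional theorem discharges nothing it binds.
-/

set_option autoImplicit false

noncomputable section

open Metric Set Function
open scoped Pointwise TensorProduct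

namespace Summit.ABC.IUTFork.Thm311.Real

open NumberField IsDedekindDomain Literature.NumberTheory.NumberFields Literature.IUT.LogVolume
open Literature.NumberTheory.GaloisRepresentations Literature.NumberTheory.GaloisRepresentations.Ultrametric
open Literature.AnabelianGeometry.AbsoluteAnabelian Literature.IUT.HodgeArakelov
open Literature.IUT.HodgeArakelov.AbsTopMonoids

section GenuineFactors

variable {K : Type} [Field K] [NumberField K] (p : ℕ) [hp : Fact p.Prime]
variable {I : Type} [Fintype I] [DecidableEq I] (w : I → HeightOneSpectrum (𝓞 K)) (hw : ∀ i, ((p : ℕ) : 𝓞 K) ∈ (w i).asIdeal)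

/-! ## §1 Packet level: NO bit anywhere under `(r+2)/e_{i₀} + Σ_{i≠i₀} 1/e_i ≤ 1` -/

/-- **PRINT SIDE — THE JUNCTION at the packet with NO BIT and NO RESIDUE-DEGREE HYPOTHESIS, under the ROOM INEQUALITY (modulo
`JannsenWingbergMappingClass`).**  Packet of R21/R22/R24 (every factor TAME of ODD local degree `≥ 3`, `‖g‖ = p^{−v/e_{i₀}}`, `A = (v−1) div e_{i₀} + 1 − |I|`,
`r = (v − 1) mod e_{i₀}`).  If `(r + 2)/e_{i₀} + Σ_{i ≠ i₀} 1/e_i ≤ 1`, then for every `H ≤ indTwo` containing the single-factor strip moves the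
`(R_I)^∼`-hull of the `H`-orbit of `ι_{i₀}(g)·(R_I)^∼` IS `packetHull(p^{A}·log_p(R_I^×))` — whatever the residue degrees, with NO depth-`e` bit (file (A) §2 at
`S = ∅`: the profile `n_i = e_i − 1` everywhere; the inequality forces `e_i ≥ 2` at every factor and `e_{i₀} ≥ r + 2`).
[claim: Mochizuki2012, status: disputed] [cite: Mochizuki2012, IUTchIII Thm. 3.11 (i) p. 154; Cor. 3.12 Step (xi) p. 183; IUTchIV Prop. 1.1 p. 9, Prop. 1.2 (ii) p. 10–11]
[cite: Kondo2025OuterAutMLF, §3 Thm 3.17, Rem 3.18] [cite: DupuyHilado2025, §4.9, §4.12] -/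
theorem packetHull_iUnion_image_iota_smul_normalizedPacket_eq_of_room_of_jannsenWingbergMappingClass [Nonempty I]
    (hMC : JannsenWingbergMappingClass) (hp2 : 2 < p)
    (he : ∀ i, absRamificationIdx p (RescaledCompletion K p (w i) (hw i)) ≤ p - 2)
    (h3 : ∀ i, 3 ≤ localDeg K (w i)) (hodd : ∀ i, Odd (localDeg K (w i)))
    (i₀ : I) {g : RescaledCompletion K p (w i₀) (hw i₀)} {v : ℤ}
    (hv : ‖g‖ = (p : ℝ) ^ (-(v / (absRamificationIdx p (RescaledCompletion K p (w i₀) (hw i₀)) : ℝ))))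
    (hroom : (((v - 1) % (absRamificationIdx p (RescaledCompletion K p (w i₀) (hw i₀)) : ℤ) + 2 : ℤ) : ℝ) /
        (absRamificationIdx p (RescaledCompletion K p (w i₀) (hw i₀)) : ℝ) +
      ∑ i ∈ Finset.univ.erase i₀, (1 : ℝ) / (absRamificationIdx p (RescaledCompletion K p (w i) (hw i)) : ℝ) ≤ 1)
    (H : Subgroup (PacketAlgebra p (fun i => RescaledCompletion K p (w i) (hw i)) ≃ₗ[ℚ_[p]]
      PacketAlgebra p (fun i => RescaledCompletion K p (w i) (hw i))))
    (hH : H ≤ indTwo p (fun i => RescaledCompletion K p (w i) (hw i)))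
    (hstrip : ∀ (i₁ : I), ∀ ψ ∈ ind1StripOf (w i₁) (galoisLog (w i₁)), ∃ γ ∈ H,
      ∀ z : Π i, RescaledCompletion K p (w i) (hw i),
        (γ : PacketAlgebra p (fun i => RescaledCompletion K p (w i) (hw i)) ≃ₗ[ℚ_[p]]
            PacketAlgebra p (fun i => RescaledCompletion K p (w i) (hw i))) (PiTensorProduct.tprod ℚ_[p] z) =
          PiTensorProduct.tprod ℚ_[p] (update z i₁ (RescaledCompletion.of K p (w i₁) (hw i₁)
            (ψ ((RescaledCompletion.of K p (w i₁) (hw i₁)).symm (z i₁)))))) :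
    packetHull p (fun i => RescaledCompletion K p (w i) (hw i))
        (⋃ γ : H, (γ : PacketAlgebra p (fun i => RescaledCompletion K p (w i) (hw i)) ≃ₗ[ℚ_[p]]
            PacketAlgebra p (fun i => RescaledCompletion K p (w i) (hw i))) ''
          (iota p (fun i => RescaledCompletion K p (w i) (hw i)) i₀ g •
            (normalizedPacket p (fun i => RescaledCompletion K p (w i) (hw i)) :
              Set (PacketAlgebra p (fun i => RescaledCompletion K p (w i) (hw i)))))) =
      packetHull p (fun i => RescaledCompletion K p (w i) (hw i))
        (((p : ℚ_[p]) ^ ((v - 1) / (absRamificationIdx p (RescaledCompletion K p (w i₀) (hw i₀)) : ℤ) + 1 - Fintype.card I)) •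
          (logPacket p (fun i => RescaledCompletion K p (w i) (hw i)) :
            Set (PacketAlgebra p (fun i => RescaledCompletion K p (w i) (hw i))))) := by
  set E : ℕ := absRamificationIdx p (RescaledCompletion K p (w i₀) (hw i₀)) with hE
  have hE0r : (0 : ℝ) < (E : ℝ) := by exact_mod_cast absRamificationIdx_pos p (RescaledCompletion K p (w i₀) (hw i₀))
  have hroom' : ((((v - 1) % (E : ℤ)) + 1 : ℤ) : ℝ) / (E : ℝ) +
      ∑ i ∈ Finset.univ \ (∅ : Finset I), (1 : ℝ) / (absRamificationIdx p (RescaledCompletion K p (w i) (hw i)) : ℝ) ≤ 1 := by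
    rw [Finset.sdiff_empty, ← Finset.add_sum_erase Finset.univ
      (fun i => (1 : ℝ) / (absRamificationIdx p (RescaledCompletion K p (w i) (hw i)) : ℝ)) (Finset.mem_univ i₀)]
    have hsplit : ((((v - 1) % (E : ℤ)) + 1 : ℤ) : ℝ) / (E : ℝ) + 1 / (E : ℝ) = ((((v - 1) % (E : ℤ)) + 2 : ℤ) : ℝ) / (E : ℝ) := by
      push_cast; field_simp; ring
    change ((((v - 1) % (E : ℤ)) + 1 : ℤ) : ℝ) / (E : ℝ) + (1 / (E : ℝ) +
      ∑ i ∈ Finset.univ.erase i₀, (1 : ℝ) / (absRamificationIdx p (RescaledCompletion K p (w i) (hw i)) : ℝ)) ≤ 1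
    linarith [hsplit]
  exact packetHull_iUnion_image_iota_smul_normalizedPacket_eq_of_bitsOn_of_jannsenWingbergMappingClass p w hw hMC hp2 he h3 hodd i₀ hv ∅
    hroom' (fun i hi => absurd hi (Finset.notMem_empty i)) H hH hstrip

/-! ## §2 Packet level: ONE bit, at ANY factor `b`, under `(r+1)/e_{i₀} + Σ_{i≠b} 1/e_i ≤ 1` -/

/-- **PRINT SIDE — THE ONE-BIT TRANSFER FORM (modulo `JannsenWingbergMappingClass`).**  Same packet; `b` ANY factor (the slot or not).  If
`(r + 1)/e_{i₀} + Σ_{i ≠ b} 1/e_i ≤ 1` and — only in case `f(w_b|p) = 1` — some realised strip automorphism at `w_b` moves `ℤ_p·p` modulo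
`p·log_p(𝒪_{w_b}^×)`, then for every `H ≤ indTwo` containing the single-factor strip moves the `(R_I)^∼`-hull of the `H`-orbit of `ι_{i₀}(g)·(R_I)^∼` IS
`packetHull(p^{A}·log_p(R_I^×))` (file (A) §2 at `S = {b}`: full depth at `b`, depth `e_i − 1` elsewhere).  So ONE bit anywhere in the packet replaces
R24's whole off-slot bit family as soon as the other factors leave `(r+1)/e_{i₀}` of room — two equally ramified factors `e`: `r ≤ e − 2`, EITHER bit.
[claim: Mochizuki2012, status: disputed] [cite: Mochizuki2012, IUTchIII Thm. 3.11 (i) p. 154; Cor. 3.12 Step (xi) p. 183; IUTchIV Prop. 1.1 p. 9, Prop. 1.2 (ii) p. 10–11]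
[cite: Kondo2025OuterAutMLF, §3 Thm 3.17, Rem 3.18] [cite: DupuyHilado2025, §4.9, §4.12] -/
theorem packetHull_iUnion_image_iota_smul_normalizedPacket_eq_of_oneBit_of_jannsenWingbergMappingClass [Nonempty I]
    (hMC : JannsenWingbergMappingClass) (hp2 : 2 < p)
    (he : ∀ i, absRamificationIdx p (RescaledCompletion K p (w i) (hw i)) ≤ p - 2)
    (h3 : ∀ i, 3 ≤ localDeg K (w i)) (hodd : ∀ i, Odd (localDeg K (w i)))
    (i₀ : I) {g : RescaledCompletion K p (w i₀) (hw i₀)} {v : ℤ}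
    (hv : ‖g‖ = (p : ℝ) ^ (-(v / (absRamificationIdx p (RescaledCompletion K p (w i₀) (hw i₀)) : ℝ))))
    (b : I)
    (hroom : (((v - 1) % (absRamificationIdx p (RescaledCompletion K p (w i₀) (hw i₀)) : ℤ) + 1 : ℤ) : ℝ) /
        (absRamificationIdx p (RescaledCompletion K p (w i₀) (hw i₀)) : ℝ) +
      ∑ i ∈ Finset.univ.erase b, (1 : ℝ) / (absRamificationIdx p (RescaledCompletion K p (w i) (hw i)) : ℝ) ≤ 1)
    (hbit : (w b).asIdeal.inertiaDeg ℤ = 1 →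
      ∃ ψ ∈ ind1StripOf (w b) (galoisLog (w b)),
        RescaledCompletion.of K p (w b) (hw b) (ψ (p : (w b).adicCompletion K)) - (p : RescaledCompletion K p (w b) (hw b)) ∉
          (p : ℚ_[p]) • logUnits (RescaledCompletion K p (w b) (hw b)))
    (H : Subgroup (PacketAlgebra p (fun i => RescaledCompletion K p (w i) (hw i)) ≃ₗ[ℚ_[p]]
      PacketAlgebra p (fun i => RescaledCompletion K p (w i) (hw i))))
    (hH : H ≤ indTwo p (fun i => RescaledCompletion K p (w i) (hw i)))
    (hstrip : ∀ (i₁ : I), ∀ ψ ∈ ind1StripOf (w i₁) (galoisLog (w i₁)), ∃ γ ∈ H,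
      ∀ z : Π i, RescaledCompletion K p (w i) (hw i),
        (γ : PacketAlgebra p (fun i => RescaledCompletion K p (w i) (hw i)) ≃ₗ[ℚ_[p]]
            PacketAlgebra p (fun i => RescaledCompletion K p (w i) (hw i))) (PiTensorProduct.tprod ℚ_[p] z) =
          PiTensorProduct.tprod ℚ_[p] (update z i₁ (RescaledCompletion.of K p (w i₁) (hw i₁)
            (ψ ((RescaledCompletion.of K p (w i₁) (hw i₁)).symm (z i₁)))))) :
    packetHull p (fun i => RescaledCompletion K p (w i) (hw i))
        (⋃ γ : H, (γ : PacketAlgebra p (fun i => RescaledCompletion K p (w i) (hw i)) ≃ₗ[ℚ_[p]]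
            PacketAlgebra p (fun i => RescaledCompletion K p (w i) (hw i))) ''
          (iota p (fun i => RescaledCompletion K p (w i) (hw i)) i₀ g •
            (normalizedPacket p (fun i => RescaledCompletion K p (w i) (hw i)) :
              Set (PacketAlgebra p (fun i => RescaledCompletion K p (w i) (hw i)))))) =
      packetHull p (fun i => RescaledCompletion K p (w i) (hw i))
        (((p : ℚ_[p]) ^ ((v - 1) / (absRamificationIdx p (RescaledCompletion K p (w i₀) (hw i₀)) : ℤ) + 1 - Fintype.card I)) •
          (logPacket p (fun i => RescaledCompletion K p (w i) (hw i)) :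
            Set (PacketAlgebra p (fun i => RescaledCompletion K p (w i) (hw i))))) := by
  rw [← Finset.sdiff_singleton_eq_erase] at hroom
  exact packetHull_iUnion_image_iota_smul_normalizedPacket_eq_of_bitsOn_of_jannsenWingbergMappingClass p w hw hMC hp2 he h3 hodd i₀ hv {b}
    hroom (fun i hi => by rw [Finset.mem_singleton] at hi; subst hi; exact hbit) H hH hstrip

end GenuineFactors

/-! ## §3 Place-section level: the junction under the room inequality, no bit displayed -/

section PlaceSection

variable {F₀ : Type} [Field F₀] [NumberField F₀] {K : Type} [Field K] [NumberField K] [Algebra F₀ K]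
variable (σ : PlaceSection F₀ K) (p : ℕ) [hp : Fact p.Prime]
variable (c : (j : ℕ) → (Fin (j + 1) → placesOver F₀ p) → ℚ_[p]) (hc0 : ∀ j e, c j e ≠ 0)
  (hcσ : ∀ (j : ℕ) (τ : Equiv.Perm (Fin (j + 1))) (e : Fin (j + 1) → placesOver F₀ p), c j (e ∘ τ) = c j e)

/-- **THE PACKET–THETA JUNCTION under the ROOM INEQUALITY, NO BIT (modulo `JannsenWingbergMappingClass`).**  Setting of R21/R22/R24 at one collection
`v⃗` of a genuine place-section packet (every factor tame of odd local degree `≥ 3`, `‖t_{i,v_j}‖ = p^{−v/e(v̲_j|p)}`, `H ≤ indTwo` containing the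
single-factor (Ind1) strip moves); NO residue hypothesis and NO bit — instead `(r + 2)/e(v̲_j|p) + Σ_{b ≠ j} 1/e(v̲_b|p) ≤ 1`, `r = (v − 1) mod e(v̲_j|p)`.
Conclusion unchanged: the `(R_I)^∼`-hull of the `H`-orbit of `O_𝕃(−P_Θ)_{v⃗}` equals `slotImagesHull`. [claim: Mochizuki2012, status: disputed]
[cite: Mochizuki2012, IUTchIII Thm. 3.11 (i) p. 154; Cor. 3.12 Step (x)/(xi) pp. 181–183] [cite: Kondo2025OuterAutMLF, §3 Thm 3.17, Rem 3.18]
[cite: DupuyHilado2025, §4.9, §4.12] -/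
theorem localFields_packetHull_orbitH_pilotRegion_eq_slotImagesHull_of_room_of_jannsenWingbergMappingClass
    (hMC : JannsenWingbergMappingClass) (hp2 : 2 < p) {lstar : ℕ}
    (t : Fin lstar → (v : placesOver F₀ p) → ((σ.localFields p).k v)ˣ) (i : Fin lstar)
    (e : Fin ((i : ℕ) + 1 + 1) → placesOver F₀ p)
    (he : ∀ b, absRamificationIdx p ((σ.localFields p).k (e b)) ≤ p - 2)
    (h3 : ∀ b, 3 ≤ localDeg K (σ.lift (e b).1)) (hodd : ∀ b, Odd (localDeg K (σ.lift (e b).1)))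
    {v : ℤ} (hv : ‖(t i (e (Fin.last _)) : (σ.localFields p).k (e (Fin.last _)))‖ =
      (p : ℝ) ^ (-(v / (absRamificationIdx p ((σ.localFields p).k (e (Fin.last _))) : ℝ))))
    (hroom : (((v - 1) % (absRamificationIdx p ((σ.localFields p).k (e (Fin.last _))) : ℤ) + 2 : ℤ) : ℝ) /
        (absRamificationIdx p ((σ.localFields p).k (e (Fin.last _))) : ℝ) +
      ∑ b ∈ Finset.univ.erase (Fin.last _), (1 : ℝ) / (absRamificationIdx p ((σ.localFields p).k (e b)) : ℝ) ≤ 1)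
    (H : Subgroup (PacketAlgebra p (fun b => (σ.localFields p).k (e b)) ≃ₗ[ℚ_[p]]
      PacketAlgebra p (fun b => (σ.localFields p).k (e b))))
    (hH : H ≤ indTwo p (fun b => (σ.localFields p).k (e b)))
    (hstrip : ∀ (b₀ : Fin ((i : ℕ) + 1 + 1)),
      ∀ ψ ∈ ind1StripOf (σ.lift (e b₀).1) (galoisLog (σ.lift (e b₀).1)), ∃ γ ∈ H,
        ∀ z : ∀ b, (σ.localFields p).k (e b),
          (γ : PacketAlgebra p (fun b => (σ.localFields p).k (e b)) ≃ₗ[ℚ_[p]]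
              PacketAlgebra p (fun b => (σ.localFields p).k (e b))) (PiTensorProduct.tprod ℚ_[p] z) =
            PiTensorProduct.tprod ℚ_[p] (update z b₀
              (RescaledCompletion.of K p (σ.lift (e b₀).1) (σ.natCast_mem_lift (e b₀))
                (ψ ((RescaledCompletion.of K p (σ.lift (e b₀).1) (σ.natCast_mem_lift (e b₀))).symm (z b₀)))))) :
    packetHull p (fun b => (σ.localFields p).k (e b))
        (⋃ γ : H, (γ : PacketAlgebra p (fun b => (σ.localFields p).k (e b)) ≃ₗ[ℚ_[p]]
            PacketAlgebra p (fun b => (σ.localFields p).k (e b))) ''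
          (realPrimePacketWith p (σ.localFields p) c hc0 hcσ).pilotRegion t ((i : ℕ) + 1) e) =
      (realPrimePacketWith p (σ.localFields p) c hc0 hcσ).slotImagesHull
        ((realPrimePacketWith p (σ.localFields p) c hc0 hcσ).pilotRegion t) ((i : ℕ) + 1) e := by
  have hcore := packetHull_iUnion_image_iota_smul_normalizedPacket_eq_of_room_of_jannsenWingbergMappingClass p
    (fun b => σ.lift (e b).1) (fun b => σ.natCast_mem_lift (e b)) hMC hp2 he h3 hodd (Fin.last _) hv hroom H hH hstrip
  obtain ⟨-, hcont⟩ := packetHull_iUnion_image_iota_smul_normalizedPacket_subset_of_tame p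
    (fun b => σ.lift (e b).1) (fun b => σ.natCast_mem_lift (e b)) hp2 he (Fin.last _) hv
    (indTwo p (fun b => (σ.localFields p).k (e b))) le_rfl
  refine Set.Subset.antisymm ?_ ?_
  · exact packetHull_mono p _
      (realPrimePacketWith_orbitH_subset_slotImages p (σ.localFields p) c hc0 hcσ t i e H hH)
  · change packetHull p _ ((realPrimePacketWith p (σ.localFields p) c hc0 hcσ).slotImages _ _ e) ⊆ _
    rw [realPrimePacketWith_slotImages_pilotRegion_eq,
      Set.iUnion_congr (fun γ => indTwo_smul_set p (fun b => (σ.localFields p).k (e b)) γ _),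
      realPrimePacketWith_pilotRegion_succ_eq]
    refine hcont.trans (le_of_eq ?_)
    exact hcore.symm

/-! ## §4 Place-section level: the junction with ONE bit at any factor of the collection -/

/-- **THE PACKET–THETA JUNCTION with ONE BIT at ANY factor `b₁` of the collection (modulo `JannsenWingbergMappingClass`).**  Same setting; the room
inequality `(r + 1)/e(v̲_j|p) + Σ_{b ≠ b₁} 1/e(v̲_b|p) ≤ 1` and — only if `f(v̲_{b₁}|p) = 1` — some realised strip automorphism at `v̲_{b₁}` moving `ℤ_p·p`
modulo `p·log_p(𝒪^×)`.  Conclusion: the `(R_I)^∼`-hull of the `H`-orbit of `O_𝕃(−P_Θ)_{v⃗}` equals `slotImagesHull`. [claim: Mochizuki2012, status: disputed]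
[cite: Mochizuki2012, IUTchIII Thm. 3.11 (i) p. 154; Cor. 3.12 Step (x)/(xi) pp. 181–183] [cite: Kondo2025OuterAutMLF, §3 Thm 3.17, Rem 3.18]
[cite: DupuyHilado2025, §4.9, §4.12] -/
theorem localFields_packetHull_orbitH_pilotRegion_eq_slotImagesHull_of_oneBit_of_jannsenWingbergMappingClass
    (hMC : JannsenWingbergMappingClass) (hp2 : 2 < p) {lstar : ℕ}
    (t : Fin lstar → (v : placesOver F₀ p) → ((σ.localFields p).k v)ˣ) (i : Fin lstar)
    (e : Fin ((i : ℕ) + 1 + 1) → placesOver F₀ p)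
    (he : ∀ b, absRamificationIdx p ((σ.localFields p).k (e b)) ≤ p - 2)
    (h3 : ∀ b, 3 ≤ localDeg K (σ.lift (e b).1)) (hodd : ∀ b, Odd (localDeg K (σ.lift (e b).1)))
    {v : ℤ} (hv : ‖(t i (e (Fin.last _)) : (σ.localFields p).k (e (Fin.last _)))‖ =
      (p : ℝ) ^ (-(v / (absRamificationIdx p ((σ.localFields p).k (e (Fin.last _))) : ℝ))))
    (b₁ : Fin ((i : ℕ) + 1 + 1))
    (hroom : (((v - 1) % (absRamificationIdx p ((σ.localFields p).k (e (Fin.last _))) : ℤ) + 1 : ℤ) : ℝ) /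
        (absRamificationIdx p ((σ.localFields p).k (e (Fin.last _))) : ℝ) +
      ∑ b ∈ Finset.univ.erase b₁, (1 : ℝ) / (absRamificationIdx p ((σ.localFields p).k (e b)) : ℝ) ≤ 1)
    (hbit : (σ.lift (e b₁).1).asIdeal.inertiaDeg ℤ = 1 →
      ∃ ψ ∈ ind1StripOf (σ.lift (e b₁).1) (galoisLog (σ.lift (e b₁).1)),
        RescaledCompletion.of K p (σ.lift (e b₁).1) (σ.natCast_mem_lift (e b₁)) (ψ (p : (σ.lift (e b₁).1).adicCompletion K)) -
            (p : RescaledCompletion K p (σ.lift (e b₁).1) (σ.natCast_mem_lift (e b₁))) ∉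
          (p : ℚ_[p]) • logUnits (RescaledCompletion K p (σ.lift (e b₁).1) (σ.natCast_mem_lift (e b₁))))
    (H : Subgroup (PacketAlgebra p (fun b => (σ.localFields p).k (e b)) ≃ₗ[ℚ_[p]]
      PacketAlgebra p (fun b => (σ.localFields p).k (e b))))
    (hH : H ≤ indTwo p (fun b => (σ.localFields p).k (e b)))
    (hstrip : ∀ (b₀ : Fin ((i : ℕ) + 1 + 1)),
      ∀ ψ ∈ ind1StripOf (σ.lift (e b₀).1) (galoisLog (σ.lift (e b₀).1)), ∃ γ ∈ H,
        ∀ z : ∀ b, (σ.localFields p).k (e b),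
          (γ : PacketAlgebra p (fun b => (σ.localFields p).k (e b)) ≃ₗ[ℚ_[p]]
              PacketAlgebra p (fun b => (σ.localFields p).k (e b))) (PiTensorProduct.tprod ℚ_[p] z) =
            PiTensorProduct.tprod ℚ_[p] (update z b₀
              (RescaledCompletion.of K p (σ.lift (e b₀).1) (σ.natCast_mem_lift (e b₀))
                (ψ ((RescaledCompletion.of K p (σ.lift (e b₀).1) (σ.natCast_mem_lift (e b₀))).symm (z b₀)))))) :
    packetHull p (fun b => (σ.localFields p).k (e b))
        (⋃ γ : H, (γ : PacketAlgebra p (fun b => (σ.localFields p).k (e b)) ≃ₗ[ℚ_[p]]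
            PacketAlgebra p (fun b => (σ.localFields p).k (e b))) ''
          (realPrimePacketWith p (σ.localFields p) c hc0 hcσ).pilotRegion t ((i : ℕ) + 1) e) =
      (realPrimePacketWith p (σ.localFields p) c hc0 hcσ).slotImagesHull
        ((realPrimePacketWith p (σ.localFields p) c hc0 hcσ).pilotRegion t) ((i : ℕ) + 1) e := by
  have hcore := packetHull_iUnion_image_iota_smul_normalizedPacket_eq_of_oneBit_of_jannsenWingbergMappingClass p
    (fun b => σ.lift (e b).1) (fun b => σ.natCast_mem_lift (e b)) hMC hp2 he h3 hodd (Fin.last _) hv b₁ hroom hbit H hH hstrip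
  obtain ⟨-, hcont⟩ := packetHull_iUnion_image_iota_smul_normalizedPacket_subset_of_tame p
    (fun b => σ.lift (e b).1) (fun b => σ.natCast_mem_lift (e b)) hp2 he (Fin.last _) hv
    (indTwo p (fun b => (σ.localFields p).k (e b))) le_rfl
  refine Set.Subset.antisymm ?_ ?_
  · exact packetHull_mono p _
      (realPrimePacketWith_orbitH_subset_slotImages p (σ.localFields p) c hc0 hcσ t i e H hH)
  · change packetHull p _ ((realPrimePacketWith p (σ.localFields p) c hc0 hcσ).slotImages _ _ e) ⊆ _
    rw [realPrimePacketWith_slotImages_pilotRegion_eq,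
      Set.iUnion_congr (fun γ => indTwo_smul_set p (fun b => (σ.localFields p).k (e b)) γ _),
      realPrimePacketWith_pilotRegion_succ_eq]
    refine hcont.trans (le_of_eq ?_)
    exact hcore.symm

end PlaceSection

end Summit.ABC.IUTFork.Thm311.Real
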